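import Summits.MatrixMultiplication.MatrixMultiplication.Theorems.AbelianSTPPCensusShapeCertVQDefsP

/-!
# Abelian STPP census — the vQ certificate checker `ShapeCertVQ.checkQS` (sharper budgets, blocked candidate walk): definitions

Cell mm-stpp, rung F-M1; successor kernel item VQ-CERT (T_E beyond 337 under vQ := vP ∧ E3⁺) in support of the closed crux item
stmt-MatrixMultiplication-19191; seat mm-stpp-vp-p2 (gen 2).

`checkQS M` decides the same question as vp-p2 g1's budgeted search `ShapeCertVQ.checkQE M` (`…ShapeCertVQDefsE`: eng-2's shape records
and hereditary vM test, theory g6's U11-G node kill and Grynkiewicz continuation bound, the E3⁺ node kill, g1's exact-regime E3⁺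
continuation budget `qE`) with five changes that cut the kernel cost of one order by a factor `4–9` (seat sizing, `work/Sizing.lean`:
order `460`: nodes `51 516 → 20 728`, candidate steps `691 399 → 59 223`, walk iterations `2.2·10⁶ → 2.1·10⁵`):
* the **saturated-regime E3⁺ continuation budget** `qS` (`qSOfT`): for a prefix member `t = (x,y,z)`, `V = xyz`, `2V > M`, untruncated
  slacks `s_X = M − V − S_X` (`S_X` = the prefix's off-member packing sums), `σ = s_A + s_B + s_C`, `c = M + 1 − (largest pair-sum of sides)`,
  `m₀ = min(x,y,z)`, every vQ-admissible family above the prefix has tail packing mass `≤ (σ − V) + ⌊(V² − V(2m₀ − 1)) / c⌋`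
  (`…ShapeCertVQBudgetS`; g1's `qE` needs the prefix itself in the exact regime `σ ≤ V`, where it is sharper; the node budget is
  `q = min q0 (min qE qS)`, `qOfS`);
* the **packing skip**: a candidate whose own packing mass `ab + bc + ca` exceeds `q` is skipped in the walk (it cannot be a tail member);
* the **first-member test with the rest budget** `q − (ab + bc + ca)` in place of `q`;
* the **child budget prune** inside the candidate step: the extended prefix is discarded when its gain plus `(table ratio) · min (q − uu)
  (budget of the extended prefix)` cannot beat — before the vM test and the recursion;
* the **blocked candidate walk with a level cap**: the candidate pool is kept as the list of its ratio-level blocks (`candBQ`, levels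
  descending); a block of level `L ≥ lcapS q vl` is passed over in one step, because a shape with packing mass `≤ q` and volume `≤ vl` has
  `243·L⁴ ≤ 64⁴·q` and `729·L⁶ ≤ 64⁶·vl` (`capOKQ`, kernel-checked over the universe in `…ShapeCertVQTablesS`).
Kernel evaluation is split below the root by PATH SEGMENTS over the blocked pool (`pathOutS` = a range of blocks of a node, `pathInS` = a
range of members of one block), assembled by the lemmas of `…ShapeCertVQSearchS`; the node-level decision `nodeDecQE` of `…DefsP` is
budget-free and reused.
Soundness: `…ShapeCertVQ{TablesS,BudgetS,SearchS}`; bridge to `SieveAdmissibleVP ∧ E3pAdm → ¬ Beats (5/2)`: `…ShapeCertVQFinalS`; kernel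
evaluations `…ShapeCertVQEvalS*`.
WHAT THIS IS NOT: no statement about STPP families or `ω` by itself; nothing about orders `> 489`; no new rule (E3⁺ is p491649's, its
shape form p519811's) — a sharper use of the same rules inside the same search.
-/

set_option linter.dupNamespace false -- `MatrixMultiplication.MatrixMultiplication` (summit = problem, D-0017)
set_option autoImplicit false

namespace Summit.MatrixMultiplication.MatrixMultiplication.Theorems.ShapeCertVQ

open ShapeCert ShapeCertVP STPPThreeRoomEnergy

/-! ### The saturated-regime E3⁺ continuation budget of a prefix -/

/-- Saturated-regime E3⁺ continuation budget of one prefix member `t` (aggregates `A` of the prefix), `none` when it gives no constraint: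
requires `2V_t > M`, untruncated slacks and a positive slope `c = M + 1 − mpS t`; value `(σ − V) + (V² − V(2·min side − 1)) / c`
(truncated subtractions). -/
def qSOfT (M : ℕ) (A : Agg) (t : Sh) : Option ℕ :=
  seqN (A.sbc - t.bc) fun SA => seqN (A.sca - t.ca) fun SB => seqN (A.sab - t.ab) fun SC =>
  if M < 2 * t.V ∧ t.V + SA ≤ M ∧ t.V + SB ≤ M ∧ t.V + SC ≤ M then
    seqN (M - t.V - SA + (M - t.V - SB) + (M - t.V - SC)) fun σ => seqN (M + 1 - mpS t) fun c =>
      if 0 < c then some ((σ - t.V) + (t.V * t.V - t.V * (2 * min t.a (min t.b t.c) - 1)) / c) else none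
  else none

/-- Saturated-regime E3⁺ continuation budget of a prefix, capped by `q`: the least member budget (or `q`). -/
def qSOf (M : ℕ) (A : Agg) (fam : List Sh) (q : ℕ) : ℕ :=
  fam.foldr (fun t acc => match qSOfT M A t with | none => acc | some b => min acc b) q

/-- The tail packing budget of a prefix with aggregates `A`: eng-2's `q0`, capped by g1's exact-regime budget `qE` and by `qS`. -/
def qOfS (M : ℕ) (A : Agg) (fam : List Sh) : ℕ := qSOf M A fam (qEOf M A fam (A.q0 M))

/-! ### The level cap of a node -/

/-- A shape of packing mass `≤ q` and volume `≤ vl` can have ratio level `L` only if `243·L⁴ ≤ 64⁴·q` and `729·L⁶ ≤ 64⁶·vl`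
(`…TablesS.capOKQ_of_inUniv`: every universe shape satisfies both with its own mass and volume). -/
def capP (q vl L : ℕ) : Bool := decide (243 * L ^ 4 ≤ 16777216 * q) && decide (729 * L ^ 6 ≤ 68719476736 * vl)

/-- scan the levels downward from `c`: the first `c` whose predecessor passes the cap test (fuel `n`) -/
def lcapGo (q vl : ℕ) : ℕ → ℕ → ℕ
  | 0, c => c
  | n + 1, c => if capP q vl (c - 1) then c else lcapGo q vl n (c - 1)

/-- The level cap of a node with tail budget `q` and volume cap `vl`: every level in `[lcapS q vl, hiLev)` fails the cap test, so no
tail member has such a level and the candidate blocks of these levels are passed over. -/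
def lcapS (q vl : ℕ) : ℕ := lcapGo q vl (hiLev - loLev - 1) hiLev

/-- The one-time data check behind the cap (evaluated over the universe of order `489` in `…TablesS`): the record's own level passes
the cap test with its own packing mass and volume. -/
def capOKQ (s : Sh) : Bool := capP (s.ab + s.bc + s.ca) s.V s.lev

/-! ### The blocked candidate pool -/

/-- The candidates of ratio level `L` at order `M` (the tabled triples of that level that are universe members, as evaluated records). -/
def blockQ (M L : ℕ) : List Sh :=
  (litLevQ L).filterMap fun x => if inUnivB M x.1 x.2.1 x.2.2 then (mkShQ M x.1 x.2.1 x.2.2).force some else none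

/-- The levels of the candidate blocks, descending: `58, 57, …, 12`. -/
def levelsQ : List ℕ := (List.range 47).map (58 - ·)

/-- The blocked candidate pool at order `M`: one block per level, levels descending (its flattening is `candQ M`,
`…SearchS.candBQ_flatten`). -/
def candBQ (M : ℕ) : List (List Sh) := levelsQ.map (blockQ M)

/-! ### The search -/

/-- The skip test of one candidate at a node (volume cap, packing budget, the three U11 budgets): a skipped candidate is no tail member. -/
def skipS (t : Sh) (ra rb rc vl q : ℕ) : Bool :=
  decide (vl < t.V) || decide (q < t.ab + t.bc + t.ca) || decide (ra < t.wA) || decide (rb < t.wB) || decide (rc < t.wC)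

/-- One candidate step (after `stepQ`): the first-member test with the rest budget `q − uu(t)`, the continuation bound of the extended
prefix, the child budget prune, admissibility, the U11-G kill, the recursion (child pool: the rest of the current block, then the
lower blocks). -/
def stepS (M : ℕ) (rec : List Sh → List (List Sh) → Bool) (t : Sh) (A : Agg) (fam : List Sh) (g0 q : ℕ) (sel : B8 → ℕ)
    (mdk : ℕ) (r : List Sh) (bs : List (List Sh)) : Bool :=
  seqN (q - (t.ab + t.bc + t.ca)) fun qr =>
  if g0 + t.g * K + sel (tabRQ t.lev) * min qr ((3 * M + (t.a + t.b + t.c)) / 2 - uuA A - (t.ab + t.bc + t.ca)) ≤ mdk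
  then true
  else
    (A.push t).force fun P =>
      if P.prune M (tabRQ t.lev) then true
      else if P.gs * K + (tabRQ t.lev).get (P.kOf M) * min qr (qOfS M P (t :: fam)) ≤ M * D * K then true
      else if feasP M P t (!fam.isEmpty) A.mxV A.mxP (t :: fam) then
        (if killV M P (t :: fam) then true else rec (t :: fam) ((t :: r) :: bs))
      else true

/-- The walk inside one block (members of one ratio level): break below `lb1` (closes every completion), skip non-fitting candidates,
step the others; at the end of the block continue with `k` (the value of the walk over the lower blocks). -/
def innerS (M : ℕ) (rec : List Sh → List (List Sh) → Bool) (fam : List Sh) (A : Agg) (ra rb rc vl g0 q : ℕ) (sel : B8 → ℕ)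
    (mdk lb1 : ℕ) (k : Bool) (bs : List (List Sh)) : List Sh → Bool
  | [] => k
  | t :: r =>
    if t.lev < lb1 then true
    else if skipS t ra rb rc vl q then innerS M rec fam A ra rb rc vl g0 q sel mdk lb1 k bs r
    else stepS M rec t A fam g0 q sel mdk r bs && innerS M rec fam A ra rb rc vl g0 q sel mdk lb1 k bs r

/-- The walk over the blocks: an empty block is passed, a block below the break level closes the walk, a block at or above the level
cap is passed over in one step, any other block is walked member by member; at the end the closure value `cl`. -/
def loopS (M : ℕ) (rec : List Sh → List (List Sh) → Bool) (fam : List Sh) (A : Agg) (ra rb rc vl g0 q : ℕ) (sel : B8 → ℕ)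
    (mdk lb1 lc : ℕ) (cl : Bool) : List (List Sh) → Bool
  | [] => cl
  | b :: bs =>
    match b with
    | [] => loopS M rec fam A ra rb rc vl g0 q sel mdk lb1 lc cl bs
    | t :: _ =>
      if t.lev < lb1 then true
      else if lc ≤ t.lev then loopS M rec fam A ra rb rc vl g0 q sel mdk lb1 lc cl bs
      else innerS M rec fam A ra rb rc vl g0 q sel mdk lb1 (loopS M rec fam A ra rb rc vl g0 q sel mdk lb1 lc cl bs) bs b

/-- The DFS with fuel (node logic verbatim `dfsQE`; tail budget `qOfS`, level cap `lcapS`, blocked walk). -/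
def dfsS (M : ℕ) : ℕ → List Sh → List (List Sh) → Bool
  | 0, _, _ => false
  | n + 1, fam, B =>
    (aggOf M fam).force fun A =>
      if killE M A fam then true
      else if M * D < A.gs then false
      else if A.dead M then true
      else
        let Bs := budsOf M A fam
        if Bs.tailEmpty then decide (A.gs ≤ M * D)
        else
          let S := gnodeQ (headLevQ fam) Bs
          seqN S.bud fun gB => seqN S.idx fun gi =>
            if S.ok && decide (A.gs * K + gB * (tabGQ (headLevQ fam)).get gi ≤ M * D * K) then true
            else
              seqN (A.ra M) fun ra => seqN (A.rb M) fun rb => seqN (A.rc M) fun rc => seqN (A.vl M) fun vl =>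
              seqN (A.gs * K) fun g0 => seqN (qOfS M A fam) fun q => seqN (A.kOf M) fun k =>
              seqN (M * D * K) fun mdk =>
              seqN (breakLevQ g0 q (selOf k) mdk S.ok gB gi) fun lb1 => seqN (lcapS q vl) fun lc =>
                let cl := fam.isEmpty || decide (g0 + selOf k (tabRQ loLev) * q ≤ mdk) || clAnyQ Bs g0 mdk loLev
                loopS M (dfsS M n) fam A ra rb rc vl g0 q (selOf k) mdk lb1 lc cl B

/-- The vQ certificate checker `checkQS` at order `M` (`M ≤ Mtop`). -/
def checkQS (M : ℕ) : Bool := dfsS M (M + 2) [] (candBQ M)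

/-! ### Segments of a node's walk (pieces of one kernel evaluation)

An OUTER segment is the walk over a range of blocks of the node's pool (each walked block with its full inner walk, continuation
`true`); an INNER segment is the walk over a range of members of one block.  `…SearchS` proves how they assemble
(`pathOutS_append`, `pathInS_append`, `pathOut_single_of_in`, `pathIn_single_of_child`, `pathOK_of_out`, `checkQS_of_pathOK_nil`). -/

/-- Outer segment: `loopS` limited to `n` blocks (`true` when the blocks are exhausted first), the walked blocks with continuation `true`. -/
def segOutS (M : ℕ) (rec : List Sh → List (List Sh) → Bool) (fam : List Sh) (A : Agg) (ra rb rc vl g0 q : ℕ) (sel : B8 → ℕ)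
    (mdk lb1 lc : ℕ) (cl : Bool) : ℕ → List (List Sh) → Bool
  | 0, _ => true
  | _ + 1, [] => cl
  | n + 1, b :: bs =>
    match b with
    | [] => segOutS M rec fam A ra rb rc vl g0 q sel mdk lb1 lc cl n bs
    | t :: _ =>
      if t.lev < lb1 then true
      else if lc ≤ t.lev then segOutS M rec fam A ra rb rc vl g0 q sel mdk lb1 lc cl n bs
      else innerS M rec fam A ra rb rc vl g0 q sel mdk lb1 true bs b && segOutS M rec fam A ra rb rc vl g0 q sel mdk lb1 lc cl n bs

/-- Inner segment: `innerS` with continuation `true`, limited to `n` members of the block (the lower blocks `bs` only enter the child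
pools). -/
def segInS (M : ℕ) (rec : List Sh → List (List Sh) → Bool) (fam : List Sh) (A : Agg) (ra rb rc vl g0 q : ℕ) (sel : B8 → ℕ)
    (mdk lb1 : ℕ) (bs : List (List Sh)) : ℕ → List Sh → Bool
  | 0, _ => true
  | _ + 1, [] => true
  | n + 1, t :: r =>
    if t.lev < lb1 then true
    else if skipS t ra rb rc vl q then segInS M rec fam A ra rb rc vl g0 q sel mdk lb1 bs n r
    else stepS M rec t A fam g0 q sel mdk r bs && segInS M rec fam A ra rb rc vl g0 q sel mdk lb1 bs n r

/-- The outer segment of `dfsS` at a prefix over a list of blocks, with the continuation `rec`, limited to `n` blocks (the node's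
constants recomputed exactly as in `dfsS`). -/
def nodeOutS (M : ℕ) (rec : List Sh → List (List Sh) → Bool) (fam : List Sh) (n : ℕ) (B : List (List Sh)) : Bool :=
  (aggOf M fam).force fun A =>
    let Bs := budsOf M A fam
    let S := gnodeQ (headLevQ fam) Bs
    seqN S.bud fun gB => seqN S.idx fun gi =>
    seqN (A.ra M) fun ra => seqN (A.rb M) fun rb => seqN (A.rc M) fun rc => seqN (A.vl M) fun vl =>
    seqN (A.gs * K) fun g0 => seqN (qOfS M A fam) fun q => seqN (A.kOf M) fun k =>
    seqN (M * D * K) fun mdk =>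
    seqN (breakLevQ g0 q (selOf k) mdk S.ok gB gi) fun lb1 => seqN (lcapS q vl) fun lc =>
      let cl := fam.isEmpty || decide (g0 + selOf k (tabRQ loLev) * q ≤ mdk) || clAnyQ Bs g0 mdk loLev
      segOutS M rec fam A ra rb rc vl g0 q (selOf k) mdk lb1 lc cl n B

/-- The inner segment of `dfsS` at a prefix over (part of) one block `b` with the lower blocks `bs`, limited to `n` members. -/
def nodeInS (M : ℕ) (rec : List Sh → List (List Sh) → Bool) (fam : List Sh) (bs : List (List Sh)) (n : ℕ) (b : List Sh) : Bool :=
  (aggOf M fam).force fun A =>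
    let Bs := budsOf M A fam
    let S := gnodeQ (headLevQ fam) Bs
    seqN S.bud fun gB => seqN S.idx fun gi =>
    seqN (A.ra M) fun ra => seqN (A.rb M) fun rb => seqN (A.rc M) fun rc => seqN (A.vl M) fun vl =>
    seqN (A.gs * K) fun g0 => seqN (qOfS M A fam) fun q => seqN (A.kOf M) fun k =>
    seqN (M * D * K) fun mdk =>
    seqN (breakLevQ g0 q (selOf k) mdk S.ok gB gi) fun lb1 =>
      segInS M rec fam A ra rb rc vl g0 q (selOf k) mdk lb1 bs n b

/-! ### Path nodes and path segments

A PATH is a list of pairs `(i, j)` (last step first): from the root (prefix `[]`, pool `candBQ M`), step `(i, j)` takes member `j` of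
block `i` of the current pool as the new prefix member and continues with the pool «rest of that block from `j`, then the lower blocks»
(repetitions allowed, as in the search). -/

/-- The node of a path: its prefix (newest member first) and its blocked pool. -/
def pathNodeS (M : ℕ) : List (ℕ × ℕ) → List Sh × List (List Sh)
  | [] => ([], candBQ M)
  | (i, j) :: ks =>
    match ((pathNodeS M ks).2).drop i with
    | [] => ((pathNodeS M ks).1, [])
    | b :: bs =>
      match b.drop j with
      | [] => ((pathNodeS M ks).1, bs)
      | t :: r => (t :: (pathNodeS M ks).1, (t :: r) :: bs)

/-- Outer path segment: at the node of `path` (depth `d`, continuation `dfsS M (M + 1 − d)` as in `checkQS`), the node-level decision,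
else the walk of the pool's blocks `i … i + n − 1`. -/
def pathOutS (M : ℕ) (path : List (ℕ × ℕ)) (i n : ℕ) : Bool :=
  match nodeDecQE M (pathNodeS M path).1 with
  | some v => v
  | none => nodeOutS M (dfsS M (M + 1 - path.length)) (pathNodeS M path).1 n (((pathNodeS M path).2).drop i)

/-- Inner path segment: at the node of `path`, the node-level decision, else the walk of the members `j … j + n − 1` of block `i` of
the pool. -/
def pathInS (M : ℕ) (path : List (ℕ × ℕ)) (i j n : ℕ) : Bool :=
  match nodeDecQE M (pathNodeS M path).1 with
  | some v => v
  | none =>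
    match ((pathNodeS M path).2).drop i with
    | [] => true
    | b :: bs => nodeInS M (dfsS M (M + 1 - path.length)) (pathNodeS M path).1 bs n (b.drop j)

/-- What the pieces of a node assemble to: the search accepts the node of `path` (with the fuel of `checkQS`). [bookkeeping] -/
def PathOKS (M : ℕ) (path : List (ℕ × ℕ)) : Prop :=
  dfsS M (M + 2 - path.length) (pathNodeS M path).1 (pathNodeS M path).2 = true

end Summit.MatrixMultiplication.MatrixMultiplication.Theorems.ShapeCertVQ
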